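import Summits.BirchSwinnertonDyer.BirchSwinnertonDyer.Theorems.EdixhovenFibreFiveSevenCiteConeClosers
import Summits.BirchSwinnertonDyer.BirchSwinnertonDyer.Theorems.AdditiveKolyvaginRoadManinFrameResidueProperROfSL2NeronValues
import Literature.NumberTheory.PAdicHodge.DualExpOfDeRham
import HarnessLib

/-!
# Route `EdixhovenFibreFiveSeven` — the Manin cruxes' cite-cone closers RE-KEYED on the SURJECTIVITY HALF of Kato II Prop. 1.2.3
# (TDS57 22227, KP57 23810, TDS11 22228, CORNER 23883, LOW 23884; and AKR #7 20709) — the injectivity half being a theorem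

Cell `pub/bsd-wall`, seat `bsd-line-edix-p2` g8. TOOL theorems only (no definition, no named fact, no `sorry`). The landed
closers `KatoSl2NeronClosers.*_of_sl2NeronValues` (p608010, edix-p5 g4) and `ManinFrameResidueProperROfSL2NeronValues.
maninFrameResidueProperR_of_sl2NeronValues` (p608497, manin-p1 g8) display FOUR cite-only facts {P1
`Kato2004.exists_member_sl2ZetaElement_neron_values`, (S5b-tower) `exists_smul_range_expStarCoord_tower_iff_trace_log`, hP
`cupLogInjective_and_hasDualExp_of_isDeRham` (Kato LNM 1553 II Prop. 1.2.3, both halves), hDR `isDeRham_restrictedRationalTateRep`}.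
The injectivity half of Prop. 1.2.3 is now the Literature THEOREM `PAdicHodge.cupLogInjective_of_isDeRham` (p608557), and
`PAdicHodge.cupLogInjective_and_hasDualExp_of_isDeRham_of_hasDualExp : hasDualExp_of_isDeRham → hP` (p608894); so every closer is
re-keyed here on the WEAKER `hP' : PAdicHodge.hasDualExp_of_isDeRham` (Prop. 1.2.3, surjectivity half ALONE). After this file and
its K★ sibling `…StarredOptimalManinUnitFiveSevenOfHasDualExp`, every Manin item of the route (22226, 22227, 22228, 23810, 23883,
23884) and AKR #7 (20709) is a CONDITIONAL RESULT on {P1, (S5b-tower), Kato II 1.2.3 surjectivity half, de Rham of `V_pE`}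
[+ modularity `exists_isNewformOf` for KP57 / CORNER / LOW]. Items stay OPEN; nothing cite-only is discharged here; BSD is not
proved by any of this.
-/

set_option autoImplicit false
-- the Theorems namespace of a single-conjunct summit repeats the summit name by design (D-0017)
set_option linter.dupNamespace false

noncomputable section

open Literature.NumberTheory.PAdicHodge
open Literature.NumberTheory.EllipticCurves Literature.NumberTheory.EllipticCurves.ModularForms
open Literature.NumberTheory.EllipticCurves.Kato2004
open Summit.BirchSwinnertonDyer.BirchSwinnertonDyer.Theses.EdixhovenFibreFiveSeven

namespace Summit.BirchSwinnertonDyer.BirchSwinnertonDyer.Theorems.KatoSl2NeronClosersOfHasDualExp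

/-- **TDS57 `TwistDegreeStepFiveSeven` (stmt-BirchSwinnertonDyer-22227) GRANTED P1, (S5b-tower), the surjectivity half of
Kato II 1.2.3 and de Rham** — `KatoSl2NeronClosers.twistDegreeStepFiveSeven_of_sl2NeronValues` with hP fed by
`cupLogInjective_and_hasDualExp_of_isDeRham_of_hasDualExp`. CONDITIONAL; the item is not closed by this.
[cite: Kato2004Asterisque, (8.1.3) (p. 180), Thm. 9.7 (p. 189)] [cite: Kato1993LNM1553, Ch. II Prop. 1.2.3 and Thm. 1.4.1 (3)-(4)] -/
theorem twistDegreeStepFiveSeven_of_hasDualExp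
    (hT₂ : exists_smul_range_expStarCoord_tower_iff_trace_log) (hP' : hasDualExp_of_isDeRham)
    (hDR : isDeRham_restrictedRationalTateRep) (hP1 : exists_member_sl2ZetaElement_neron_values) :
    TwistDegreeStepFiveSeven :=
  KatoSl2NeronClosers.twistDegreeStepFiveSeven_of_sl2NeronValues hT₂
    (cupLogInjective_and_hasDualExp_of_isDeRham_of_hasDualExp hP') hDR hP1

/-- **KP57 `KPResidueManinUnitFiveSeven` (stmt-BirchSwinnertonDyer-23810) GRANTED modularity, P1, (S5b-tower), the surjectivity
half of Kato II 1.2.3 and de Rham.** CONDITIONAL; the item is not closed by this.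
[cite: KostersPannekoek2017, Thm. 1 and Cor. 2] [cite: Kato2004Asterisque, (8.1.3) (p. 180), Thm. 9.7 (p. 189)] -/
theorem kpResidueManinUnitFiveSeven_of_hasDualExp (hnf : exists_isNewformOf)
    (hT₂ : exists_smul_range_expStarCoord_tower_iff_trace_log) (hP' : hasDualExp_of_isDeRham)
    (hDR : isDeRham_restrictedRationalTateRep) (hP1 : exists_member_sl2ZetaElement_neron_values) :
    KPResidueManinUnitFiveSeven :=
  KatoSl2NeronClosers.kpResidueManinUnitFiveSeven_of_sl2NeronValues hnf hT₂
    (cupLogInjective_and_hasDualExp_of_isDeRham_of_hasDualExp hP') hDR hP1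

/-- **TDS11 `TwistDegreeStepOrdinary` (stmt-BirchSwinnertonDyer-22228) GRANTED P1, (S5b-tower), the surjectivity half of
Kato II 1.2.3 and de Rham.** CONDITIONAL; the item is not closed by this.
[cite: Kato2004Asterisque, (8.1.3) (p. 180), Thm. 9.7 (p. 189)] [cite: EdixhovenManin1991, §4] -/
theorem twistDegreeStepOrdinary_of_hasDualExp
    (hT₂ : exists_smul_range_expStarCoord_tower_iff_trace_log) (hP' : hasDualExp_of_isDeRham)
    (hDR : isDeRham_restrictedRationalTateRep) (hP1 : exists_member_sl2ZetaElement_neron_values) :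
    TwistDegreeStepOrdinary :=
  KatoSl2NeronClosers.twistDegreeStepOrdinary_of_sl2NeronValues hT₂
    (cupLogInjective_and_hasDualExp_of_isDeRham_of_hasDualExp hP') hDR hP1

/-- **CORNER `KummerCornerTorsionOptimalManinUnit` (stmt-BirchSwinnertonDyer-23883) GRANTED modularity, P1, (S5b-tower), the
surjectivity half of Kato II 1.2.3 and de Rham.** CONDITIONAL; the item is not closed by this.
[cite: KostersPannekoek2017, Cor. 2] [cite: Kato2004Asterisque, Thm. 9.7 (p. 189)] -/
theorem kummerCornerTorsionOptimalManinUnit_of_hasDualExp (hnf : exists_isNewformOf)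
    (hT₂ : exists_smul_range_expStarCoord_tower_iff_trace_log) (hP' : hasDualExp_of_isDeRham)
    (hDR : isDeRham_restrictedRationalTateRep) (hP1 : exists_member_sl2ZetaElement_neron_values) :
    KummerCornerTorsionOptimalManinUnit :=
  KatoSl2NeronClosers.kummerCornerTorsionOptimalManinUnit_of_sl2NeronValues hnf hT₂
    (cupLogInjective_and_hasDualExp_of_isDeRham_of_hasDualExp hP') hDR hP1

/-- **LOW `SupersingularTorsionOptimalManinUnitFive` (stmt-BirchSwinnertonDyer-23884) GRANTED modularity, P1, (S5b-tower), the
surjectivity half of Kato II 1.2.3 and de Rham.** CONDITIONAL; the item is not closed by this.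
[cite: KostersPannekoek2017, Cor. 2] [cite: Kato2004Asterisque, Thm. 9.7 (p. 189)] -/
theorem supersingularTorsionOptimalManinUnitFive_of_hasDualExp (hnf : exists_isNewformOf)
    (hT₂ : exists_smul_range_expStarCoord_tower_iff_trace_log) (hP' : hasDualExp_of_isDeRham)
    (hDR : isDeRham_restrictedRationalTateRep) (hP1 : exists_member_sl2ZetaElement_neron_values) :
    SupersingularTorsionOptimalManinUnitFive :=
  KatoSl2NeronClosers.supersingularTorsionOptimalManinUnitFive_of_sl2NeronValues hnf hT₂
    (cupLogInjective_and_hasDualExp_of_isDeRham_of_hasDualExp hP') hDR hP1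

/-- **AKR crux #7 `ManinFrameResidueProperR` (stmt-BirchSwinnertonDyer-20709, route `AdditiveKolyvaginRoad`) GRANTED P1,
(S5b-tower), the surjectivity half of Kato II 1.2.3 and de Rham** — manin-p1 g8's
`ManinFrameResidueProperROfSL2NeronValues.maninFrameResidueProperR_of_sl2NeronValues` re-keyed. CONDITIONAL; the item is not
closed by this. [cite: Kato2004Asterisque, (8.1.3) (p. 180), Thm. 9.7 (p. 189), Thm. 13.6 (p. 227)]
[cite: Kato1993LNM1553, Ch. II Prop. 1.2.3] -/
theorem maninFrameResidueProperR_of_hasDualExp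
    (hT₂ : exists_smul_range_expStarCoord_tower_iff_trace_log) (hP' : hasDualExp_of_isDeRham)
    (hDR : isDeRham_restrictedRationalTateRep) (hP1 : exists_member_sl2ZetaElement_neron_values) :
    Summit.BirchSwinnertonDyer.BirchSwinnertonDyer.Theses.AdditiveKolyvaginRoad.ManinFrameResidueProperR :=
  ManinFrameResidueProperROfSL2NeronValues.maninFrameResidueProperR_of_sl2NeronValues hT₂
    (cupLogInjective_and_hasDualExp_of_isDeRham_of_hasDualExp hP') hDR hP1

end Summit.BirchSwinnertonDyer.BirchSwinnertonDyer.Theorems.KatoSl2NeronClosersOfHasDualExp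

end
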